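import Summits.RiemannHypothesis.RiemannHypothesis.Theorems.TiltedLandingLaw421R3BurgersRate

/-!
# TWO-PAIR DATUM (lens-2 g5, director l.7998) — a kernel instance of (T)'s binders `Touches ∧ AtomicPair ∧ floor`

Custody note for ⟨33346⟩ `TiltedLandingLaw421R`, route EarlyAppointments, law (T) `RhW08.TouchedDissipation.TouchedDissipationLawQ (c κ₀)`
(statement file `lens2/TouchedDissipation-v1.lean` cdd815ffc14364c5 = crux workfile `Cruxes/TiltedLandingLaw421R/Lens2_TouchedDissipation.lean`).
crit-1 g4 (CUT 21 (b)) observed that no tree frame carries a TOUCHING pair (`…Negative.AlphaSealDatum.fW = z⁵ + z³` has the single upper zero `i`),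
so (T)'s binders `Touches ∧ AtomicPair` were not kernel-instantiable.  This file supplies the instance, WITHOUT `EngineHyps5` / `Charged` /
`IsLowest` (the frame fields are as heavy as `AlphaSealDatum`'s 340 lines and are not attempted here — said plainly):

* `f₂ z = z³ (z² + 1) (z² − 4z + 8)` — real polynomial, zeros `0` (triple), `±i`, `2 ± 2i` (`f₂_eq_zero_iff`); level `j = 0`, `v = i`, toucher
  `z = 2 + 2i`: `Im v = 1 < 2 = Im z` and `|Re v − Re z| = 2 ≤ 3 = Im v + Im z` (the closed Jensen discs MEET; `v` is UNCOVERED: `4 = Im z² ≤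
  Im v² + (Re v − Re z)² = 5`).
* `touches_D2` — `Touches f₂ 0 i (2+2i)` written out; `atomicPair_D2` — `AtomicPair f₂ 0 i (2+2i)` written out (no other upper zero exists).
* `dslope_f₂_I`, `newtonK_D2`, `tiltAt_D2` — the state field in closed form: `dslope f₂ i = Q₂` (cofactor), `newtonK f₂ 0 i = Q₂′(i)/Q₂(i)
  = (−36 − 45i)/(14 − 8i)`, `tiltAt f₂ 0 i = (−64 − 76i)/(28 − 16i)` (`‖·‖² = 9872/1040 ≈ 9.49`).
* ★ `floor_D2 : 3 ≤ Im v · ‖tiltAt f₂ 0 v‖` — the FLOOR binder of (T) at `κ₀ = 3` (hence at every `κ₀ ≤ 3`, in particular the record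
  candidates `κ₀ ∈ {2, 3}`); the triple real zero at `0` is what makes the state field large (`3/(i − 0) = −3i`) — a touching pair ALONE has
  `κ·Im v < 1` (toucher-only field), which is the regime the floor is designed to exclude.
* `binders_D2` — the conjunction, in the exact unfolded shape of (T)'s three binders at `(f₂, 0, i, 2+2i)`; against the crux workfile the three
  conjuncts are `Touches f₂ 0 I (2+2I)`, `AtomicPair f₂ 0 I (2+2I)`, `3 ≤ I.im * stateKappa f₂ 0 I` by `Iff.rfl` (that module is not imported here:
  tree imports only).

Nothing here bears on the truth of RH; RH is not proved; (T) / ★A / 33346 / 33347 OPEN; an instance of binders is not evidence for the law.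
-/

open Complex

namespace RhW08.TwoPairDatum

/-- The two-pair datum `f₂(z) = z³ (z² + 1) (z² − 4z + 8)`. -/
def f₂ (z : ℂ) : ℂ := z ^ 3 * (z ^ 2 + 1) * (z ^ 2 - 4 * z + 8)

/-- The cofactor of the simple zero `i`: `Q₂(z) = z³ (z + i) (z² − 4z + 8)`, so that `f₂ z = (z − i)·Q₂ z`. -/
def Q₂ (z : ℂ) : ℂ := z ^ 3 * (z + I) * (z ^ 2 - 4 * z + 8)

/-- The derivative of the cofactor (product rule, unexpanded). -/
def Q₂' (z : ℂ) : ℂ :=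
  (3 * z ^ 2 * (z + I) + z ^ 3 * 1) * (z ^ 2 - 4 * z + 8) + z ^ 3 * (z + I) * (2 * z - 4)

/-- `f₂` is real on the real axis (it is a real polynomial). -/
theorem f₂_real (x : ℝ) : (f₂ x).im = 0 := by
  have h : f₂ x = ((x ^ 3 * (x ^ 2 + 1) * (x ^ 2 - 4 * x + 8) : ℝ) : ℂ) := by
    unfold f₂; push_cast; ring
  rw [h, ofReal_im]

/-- The factorisation over `ℂ`: `f₂ z = z³ (z − i)(z + i)(z − (2+2i))(z − (2−2i))`. -/
theorem f₂_factor (z : ℂ) : f₂ z = z ^ 3 * ((z - I) * (z + I)) * ((z - (2 + 2 * I)) * (z - (2 - 2 * I))) := by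
  unfold f₂
  linear_combination (z ^ 3 * (4 * (z ^ 2 + 1) + (z ^ 2 - 4 * z + 8) - 4 * (I ^ 2 + 1))) * I_sq

/-- The zero set of `f₂`: `{0, i, −i, 2+2i, 2−2i}`. -/
theorem f₂_eq_zero_iff (u : ℂ) : f₂ u = 0 ↔ u = 0 ∨ u = I ∨ u = -I ∨ u = 2 + 2 * I ∨ u = 2 - 2 * I := by
  rw [f₂_factor]
  simp only [mul_eq_zero, pow_eq_zero_iff, Ne, OfNat.ofNat_ne_zero, not_false_eq_true, sub_eq_zero, add_eq_zero_iff_eq_neg]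
  tauto

/-- `f₂ = (· − i) • Q₂` as functions. -/
theorem f₂_eq_sub_smul_Q₂ : f₂ = fun z => (z - I) • Q₂ z := by
  funext z
  rw [smul_eq_mul, f₂_factor, Q₂]
  linear_combination (-4 * z ^ 3 * (z - I) * (z + I)) * I_sq

/-- The cofactor is differentiable with derivative `Q₂'`. -/
theorem hasDerivAt_Q₂ (z : ℂ) : HasDerivAt Q₂ (Q₂' z) z := by
  have h1 : HasDerivAt (fun y : ℂ => y ^ 3) (3 * z ^ 2) z := by simpa using hasDerivAt_pow 3 z
  have h2 : HasDerivAt (fun y : ℂ => y + I) 1 z := (hasDerivAt_id' z).add_const I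
  have h3 : HasDerivAt (fun y : ℂ => y ^ 2 - 4 * y + 8) (2 * z - 4) z := by
    have h := ((hasDerivAt_pow 2 z).sub ((hasDerivAt_id' z).const_mul 4)).add_const 8
    simpa using h
  exact (h1.mul h2).mul h3

/-- The divided difference of `f₂` at its simple zero `i` IS the cofactor: `dslope f₂ i = Q₂`. -/
theorem dslope_f₂_I : dslope f₂ I = Q₂ := by
  classical
  rw [f₂_eq_sub_smul_Q₂, dslope_sub_smul]
  have hd : deriv (fun x : ℂ => (x - I) • Q₂ x) I = Q₂ I := by
    have h : HasDerivAt (fun x : ℂ => (x - I) • Q₂ x) ((I - I) • Q₂' I + (1 : ℂ) • Q₂ I) I :=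
      ((hasDerivAt_id' I).sub_const I).smul (hasDerivAt_Q₂ I)
    rw [h.deriv]
    simp
  rw [hd, Function.update_eq_self]

/-- `Q₂(i) = 14 − 8i`. -/
theorem Q₂_I : Q₂ I = 14 - 8 * I := by
  unfold Q₂
  linear_combination (2 * I ^ 4 - 8 * I ^ 3 + 14 * I ^ 2 + 8 * I - 14) * I_sq

/-- `Q₂′(i) = −36 − 45i`. -/
theorem Q₂'_I : Q₂' I = -36 - 45 * I := by
  unfold Q₂'
  linear_combination (11 * I ^ 3 - 36 * I ^ 2 + 45 * I + 36) * I_sq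

/-- The canonical Newton field value at `(f₂, 0, i)`: `K = Q₂′(i)/Q₂(i) = (−36 − 45i)/(14 − 8i)`. -/
theorem newtonK_D2 : RhW08.AntiEscapeSplit7.newtonK f₂ 0 I = (-36 - 45 * I) / (14 - 8 * I) := by
  unfold RhW08.AntiEscapeSplit7.newtonK
  rw [iteratedDeriv_zero, dslope_f₂_I, (hasDerivAt_Q₂ I).deriv, Q₂'_I, Q₂_I]

/-- `14 − 8i ≠ 0`. -/
theorem den₁_ne : (14 : ℂ) - 8 * I ≠ 0 := fun h => by simpa using congrArg Complex.re h

/-- `28 − 16i ≠ 0`. -/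
theorem den₂_ne : (28 : ℂ) - 16 * I ≠ 0 := fun h => by simpa using congrArg Complex.re h

/-- The state field (tilt) at `(f₂, 0, i)` in closed form: `tiltAt f₂ 0 i = K + i/(2·Im i) = (−64 − 76i)/(28 − 16i)`. -/
theorem tiltAt_D2 : RhW08.BurgersRate.tiltAt f₂ 0 I = (-64 - 76 * I) / (28 - 16 * I) := by
  rw [RhW08.BurgersRate.tiltAt, newtonK_D2, I_im, ofReal_one, mul_one]
  rw [div_add_div _ _ den₁_ne two_ne_zero, div_eq_div_iff (mul_ne_zero den₁_ne two_ne_zero) den₂_ne]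
  linear_combination (-8 * (28 - 16 * I)) * I_sq

/-- ★ THE FLOOR BINDER of (T) at `κ₀ = 3`: `3 ≤ Im v · ‖tiltAt f₂ 0 v‖` at `v = i` (`‖tilt‖² = 9872/1040`). -/
theorem floor_D2 : (3 : ℝ) ≤ I.im * ‖RhW08.BurgersRate.tiltAt f₂ 0 I‖ := by
  rw [tiltAt_D2, I_im, one_mul, norm_div]
  have hn : ‖(-64 : ℂ) - 76 * I‖ ^ 2 = 9872 := by
    rw [Complex.sq_norm, Complex.normSq_apply]; simp; norm_num
  have hd : ‖(28 : ℂ) - 16 * I‖ ^ 2 = 1040 := by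
    rw [Complex.sq_norm, Complex.normSq_apply]; simp; norm_num
  have hdpos : 0 < ‖(28 : ℂ) - 16 * I‖ := norm_pos_iff.2 den₂_ne
  rw [le_div_iff₀ hdpos]
  nlinarith [norm_nonneg ((-64 : ℂ) - 76 * I), norm_nonneg ((28 : ℂ) - 16 * I)]

/-- The floor at the other record candidate `κ₀ = 2` (monotone in `κ₀`). -/
theorem floor_D2_two : (2 : ℝ) ≤ I.im * ‖RhW08.BurgersRate.tiltAt f₂ 0 I‖ :=
  le_trans (by norm_num) floor_D2

/-- `Touches f₂ 0 i (2+2i)`, written out: the toucher is a zero of `f₂^{(0)}`, strictly taller, and the closed Jensen discs meet. -/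
theorem touches_D2 :
    iteratedDeriv 0 f₂ (2 + 2 * I) = 0 ∧ I.im < (2 + 2 * I).im ∧ |I.re - (2 + 2 * I).re| ≤ I.im + (2 + 2 * I).im := by
  refine ⟨?_, ?_, ?_⟩
  · rw [iteratedDeriv_zero]; exact (f₂_eq_zero_iff _).2 (Or.inr (Or.inr (Or.inr (Or.inl rfl))))
  · norm_num
  · norm_num

/-- `AtomicPair f₂ 0 i (2+2i)`, written out: every OTHER upper zero of `f₂^{(0)}` is disc-separated from both — vacuously, there is none. -/
theorem atomicPair_D2 : ∀ u : ℂ, iteratedDeriv 0 f₂ u = 0 → 0 < u.im → u ≠ I → u ≠ 2 + 2 * I →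
    I.im + u.im < |I.re - u.re| ∧ (2 + 2 * I).im + u.im < |(2 + 2 * I).re - u.re| := by
  intro u hu him hI hz
  rw [iteratedDeriv_zero, f₂_eq_zero_iff] at hu
  rcases hu with rfl | rfl | rfl | rfl | rfl
  · exact absurd him (by norm_num)
  · exact absurd rfl hI
  · exact absurd him (by norm_num)
  · exact absurd rfl hz
  · exact absurd him (by norm_num)

/-- `v = i` is UNCOVERED by the toucher (`Im z² ≤ Im v² + (Re v − Re z)²`: `4 ≤ 5`), as on every R/2-laterally-isolated lowest state. -/
theorem uncovered_D2 : (2 + 2 * I).im ^ 2 ≤ I.im ^ 2 + (I.re - (2 + 2 * I).re) ^ 2 := by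
  norm_num

/-- ★★ THE INSTANCE: (T)'s three binders `Touches ∧ AtomicPair ∧ (κ₀ ≤ Im v·κ_v)` at `(f, j, v, z, κ₀) = (f₂, 0, i, 2+2i, 3)`, in their unfolded
shape (`stateKappa f j v = ‖tiltAt f j v‖`). -/
theorem binders_D2 :
    (iteratedDeriv 0 f₂ (2 + 2 * I) = 0 ∧ I.im < (2 + 2 * I).im ∧ |I.re - (2 + 2 * I).re| ≤ I.im + (2 + 2 * I).im) ∧
    (∀ u : ℂ, iteratedDeriv 0 f₂ u = 0 → 0 < u.im → u ≠ I → u ≠ 2 + 2 * I →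
      I.im + u.im < |I.re - u.re| ∧ (2 + 2 * I).im + u.im < |(2 + 2 * I).re - u.re|) ∧
    (3 : ℝ) ≤ I.im * ‖RhW08.BurgersRate.tiltAt f₂ 0 I‖ :=
  ⟨touches_D2, atomicPair_D2, floor_D2⟩

end RhW08.TwoPairDatum
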